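import Literature.NumberTheory.EllipticCurves.BurungaleSkinnerTianWan2024.GreenbergMainStatementOPEN
import Literature.NumberTheory.EllipticCurves.YanZhu2026.GreenbergDivisibilityProofs
import Summits.BirchSwinnertonDyer.BirchSwinnertonDyer.Theorems.SignedBaseChangeK2RAssembly
import Summits.BirchSwinnertonDyer.BirchSwinnertonDyer.Theorems.SignedLowerHalvesKobayashiLowerHalfSemistableDefiniteFrameData
import HarnessLib

/-!
# Line «defmu» of crux 2 `KobayashiLowerHalfSemistable` (stmt-BirchSwinnertonDyer-19000): the ASSEMBLY, in `Theorems/`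

Route-independent `Theorems` file of the cell `bsd-ssimc`, seat `bsd-line-slh-p2` (LEAD of crux 2, gen 9). HONEST FRAMING:
nothing about any curve is asserted, NO summit statement is proved, BSD / the crux is NOT proved; every theorem below is an
IMPLICATION whose hypotheses are displayed in full — either the registered stub signatures of the skeleton of record
`Cruxes/KobayashiLowerHalfSemistable/Lines/defmu.lean` (sha256 457fecb9…, `ledger skeleton check` 2026-08-28T10:53Z; design =
crux workfile `DefanchorLine.lean` rev 5 «defmu», ideator bsd-idea-13; registration §11 and the S1bʳ / S1aʳ landings p625235 /
p625644 by this seat, gen 7) VERBATIM, or the tree's NAMED facts (`def … : Prop` binders under `Literature/`; two of them,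
`thm617_…_PRE` and `thm924_…_OPEN`, are PREPRINT claims of arXiv:2409.01350v2 and never theorems).

WHY THIS FILE. The skeleton's composition (§10 of the crux workfile: the `μ`-transfer `dvd_of_awayFromCyc_of_package`, the
descent `definiteDescentDvd`, the `5 ≤ p` branch `five_le_of_defmu`) is kernel-checked THERE, but a crux workfile carries
`sorry`s (its stubs) and is not importable from `Theorems/`. This file re-proves the composition here, against HYPOTHESES in
place of the workfile's `def`s, with the one infrastructure hypothesis S1bʳ `DefiniteFieldSupplyFromR` DISCHARGED by the
landed theorem `SemistableDefiniteFrameData.definiteFieldSupplyFromR` (p625235) and the bundle `NamedInputs₂` unbundled into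
its six named facts. Net effect (`exists_kobayashiLowerDivisibility_of_package`): the `5 ≤ p` half of crux 2 is displayed
BY THE KERNEL, in the permanent tree, as
  «S1aʳ (a ramified level prime `q₀ ∣ N`, `p ∤ v_{q₀}(Δ)`; PUB: Ribet / Diamond; tree-conditional p625644)
   ⊕ Cμ (the BSTW signed two-variable package at the definite-CR datum WITH unit content of `𝓛^∘(0,T₂)`; PRE ⊕ PUB ⊕ one
     comparison — the line's HARD stub, ONE hypothesis)
   ⊕ six named facts (BSTW Thm 6.17 frames PRE; Kobayashi 2003 Thm 1.2, Thm 4.1; modularity; the period unit; GMC_r =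
     BSTW Thm 9.24, the tree's OPEN binder)  ⟹  ∀ (W, p) on X6 with `5 ≤ p`, ∃ ε, `KobayashiLowerDivisibility W p ε`»,
so that the by-name closer of the item is a five-line file once the registered stubs are theorems (companion file
`…SemistableDefmuAssemblyStubs.lean`: the crux BODY from the four stub signatures verbatim). Precedent and model:
`Theorems/SignedBaseChangeK2RAssembly.lean` (crux K2R⁗ of route SignedBaseChange, Heegner `K`, where GMC_r is unavailable and
`μ(G⁻) = 0` carries the cancellation; at a definite `K` the roles swap and the SIGNED function carries the unit content).

THE MECHANISM (BSTW arXiv:2409.01350v2 §2.2.2–§2.3, (def)-branch; cell audit rows S1–S9; card `DefanchorLine.md` §A/§B).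
GMC_r gives a non-zero CYCLOTOMIC-variable `s(T₁)` with `s · ch(X_Gr)^ur ⊆ (G)`; the package identity (P1)
`(ξ_∘ G) = ch · (𝓛^∘)` turns it into `𝓛^∘ ∣ s(T₁) · ξ_∘` (cancel `G ≠ 0` — itself free from (P1), `ch ≠ ⊥`, `𝓛^∘ ≠ 0`);
`s(T₁)` is cancelled against the unit content of `𝓛^∘(0,T₂)` by the tree's Weierstrass-division theorem
`dvd_of_dvd_map_C_mul_of_hasUnitContent_minus`: `𝓛^∘ ∣ ξ_∘` TWO-VARIABLY (§1). The descent (§2,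
`kobayashiMainConjecture_of_twoVariableDvd`) specialises to the cyclotomic line with (P2)/(P3), descends
`𝒪_{ℂ_p}⟦T⟧ → ℤ_p⟦T⟧`, squeezes against Kato–Kobayashi (Thm 4.1, integral under `Surj`, for `W` and its `D_K`-twist `W₂`)
and renormalises by the period unit: Kobayashi's main conjecture for `(W, p, ε)`, either sign. §3 assembles the `5 ≤ p`
branch (witness `ε = 1`). All proofs are the crux workfile's §10 proofs (ideator bsd-idea-13 rev 5, there kernel-checked
against the `def`s), re-run against the hypotheses; nothing new is claimed mathematically.

Kernel state of the crux after this file: UNCHANGED (OPEN; PRE). Nothing of BSTW is asserted.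

References: [BurungaleSkinnerTianWan2024] arXiv:2409.01350v2 Props. 1.18/2.7/5.19, Thm. 6.17, Thm. 9.24, §2.3 proof of
Thm. (KoMC_r) (corpus paper:arxiv-2409.01350 p0075–p0076); [Kobayashi2003] Conj. (p. 2), Thm. 1.2, Thm. 4.1;
[PollackWeston2011] Thm. 2.5, (1); [Vatsal2003] Thm. 1.1; [Ribet1990] Thm. 1.1; [Diamond1995RefinedSerre] Thm. 1.1; cell files
`Cruxes/KobayashiLowerHalfSemistable/{Lines/defmu.lean, Lines/defmu.md, DefanchorLine.md, PICKED.md}`.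
-/

-- D-0017: single-problem summit, the namespace repeats the problem name by design.
set_option linter.dupNamespace false
set_option autoImplicit false

noncomputable section

open scoped Classical

open NumberField IsDedekindDomain Field CongruenceSubgroup
open Literature.NumberTheory.GaloisRepresentations
open Literature.NumberTheory.EllipticCurves Literature.NumberTheory.EllipticCurves.BurungaleSkinnerTianWan2024
open Literature.NumberTheory.EllipticCurves.ModularForms

namespace Summit.BirchSwinnertonDyer.BirchSwinnertonDyer.Theorems.SemistableDefmuAssembly

open Summit.BirchSwinnertonDyer.BirchSwinnertonDyer.Theorems.SignedBaseChangeK2RTransferDescent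

/-! ### §1 The `μ`-transfer through the `ℤ_p²`-package (pure algebra over `𝒪_{ℂ_p}⟦T₁⟧⟦T₂⟧`; crux workfile §10 verbatim) -/

/-- **The algebraic core of «defmu» (PROVED): GMC_r ⊕ (P1) ⊕ `μ(𝓛^∘(0,T₂)) = 0` ⊕ `G ≠ 0` ⇒ `𝓛^∘ ∣ ξ_∘` two-variably.**
From `s·ch ≤ (G)` and `(ξ G) = ch·(𝓛)`: `(s)(ξ G) ≤ (G 𝓛)`, i.e. `G 𝓛 ∣ s ξ G`; cancel `G`; then cancel the
cyclotomic-variable `s ≠ 0` against the unit content of `𝓛(0,T₂)` (`dvd_of_dvd_map_C_mul_of_hasUnitContent_minus`).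
[cite: BurungaleSkinnerTianWan2024, §2.3 proof of Thm. (KoMC'_lb), last paragraph (the `μ`-cancellation, there for `G⁻`)] -/
theorem dvd_of_awayFromCyc_of_package {p : ℕ} [Fact p.Prime]
    {xi Lsig G : PowerSeries (PowerSeries (PadicComplexInt p))} {ch : Ideal (PowerSeries (PowerSeries (PadicComplexInt p)))}
    {s : PowerSeries (PadicComplexInt p)} (hμ : GreenbergVatsal2000.HasUnitContent (UnrSeries₂.minus Lsig)) (hs : s ≠ 0)
    (h924 : Ideal.span {PowerSeries.map (PowerSeries.C (R := PadicComplexInt p)) s} * ch ≤ Ideal.span {G})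
    (hP1 : Ideal.span {xi * G} = ch * Ideal.span {Lsig}) (hG : G ≠ 0) : Lsig ∣ xi := by
  have hle : Ideal.span {PowerSeries.map (PowerSeries.C (R := PadicComplexInt p)) s} * Ideal.span {xi * G} ≤
      Ideal.span {G} * Ideal.span {Lsig} := by
    rw [hP1, ← mul_assoc]
    exact Ideal.mul_mono_left h924
  rw [Ideal.span_singleton_mul_span_singleton, Ideal.span_singleton_mul_span_singleton,
    Ideal.span_singleton_le_span_singleton] at hle
  obtain ⟨k, hk⟩ := hle
  have hk' : PowerSeries.map (PowerSeries.C (R := PadicComplexInt p)) s * xi = Lsig * k := by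
    apply mul_left_cancel₀ hG
    calc G * (PowerSeries.map (PowerSeries.C (R := PadicComplexInt p)) s * xi)
        = PowerSeries.map (PowerSeries.C (R := PadicComplexInt p)) s * (xi * G) := by ring
      _ = G * Lsig * k := hk
      _ = G * (Lsig * k) := by ring
  exact dvd_of_dvd_map_C_mul_of_hasUnitContent_minus hμ hs ⟨k, hk'⟩

/-- A series whose anticyclotomic restriction has unit content is non-zero (bookkeeping). -/
theorem ne_zero_of_hasUnitContent_minus {p : ℕ} [Fact p.Prime] {L : PowerSeries (PowerSeries (PadicComplexInt p))}
    (hμ : GreenbergVatsal2000.HasUnitContent (UnrSeries₂.minus L)) : L ≠ 0 := by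
  rintro rfl
  obtain ⟨n, hn⟩ := hμ
  simp [UnrSeries₂.minus] at hn

/-! ### §2 The descent: `𝓛^∘ ∣ ξ_∘` two-variably ⟹ Kobayashi's main conjecture for `(W, p, ε)` (crux workfile
### `definiteDescentDvd`, with its four named PUBLISHED facts as hypotheses instead of antecedents) -/

open scoped MatrixGroups ModularForm in
open WeierstrassCurve Literature.NumberTheory.EllipticCurves.Rank1Residual
  Literature.NumberTheory.EllipticCurves.BurungaleCastellaSkinner2025
  Literature.NumberTheory.EllipticCurves.Kobayashi2003 ZpExtension
  Summit.BirchSwinnertonDyer.Rank1Residual.Supersingular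
  Summit.BirchSwinnertonDyer.BirchSwinnertonDyer.Theorems.SignedBaseChangeEisensteinSqueeze
  Summit.BirchSwinnertonDyer.BirchSwinnertonDyer.Theorems.SignedBaseChangeAuxiliaryCurves
  Summit.BirchSwinnertonDyer.BirchSwinnertonDyer.Theorems.SignedBaseChangeK2RTransferDescent in
/-- **S5ʳ of line «defmu» (the descent), PROVED modulo four PUBLISHED named facts taken BY NAME** (Kobayashi 2003
Thm 1.2 `h12` and Thm 4.1 `h41`, modularity with a parametrisation datum `hmod`, the period unit `h5` — each a `Literature`
`def … : Prop`, so this theorem is CONDITIONAL on them and on nothing else): at the definite-CR datum of the line (X6,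
`5 ≤ p`, `p = v v̄` split in the imaginary quadratic `K`, `(N, D_K) = 1`, `ρ̄|_{G_K}` absolutely irreducible, `γ₁`
canonical), for every Katz/Greenberg frame `(Ω, δ, Ω_p, L_K, G)`, structure map `J`, sign `ε` and every pair `(ξ_∘, 𝓛^∘)`
with `𝓛^∘ ∣ ξ_∘` satisfying the package identity (P1) and the cyclotomic-line clauses (P2) (`ξ_∘⁺ ∣ g₁ g₂`) and (P3)
(`𝓛^{∘,+} = u · L^ε(f) L^ε(f₂)`), Kobayashi's main conjecture `KobayashiMainConjecture W p ε` holds. Proof = the crux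
workfile's `definiteDescentDvd` verbatim: auxiliary twist `W₂ ≃ W^{(D_K)}` (good at `p`, `a_p = 0`, `ρ̄` onto), conductor-level
newform uniqueness, Thm 1.2 torsion, (P2)/(P3) at the canonical `ℚ`-variable, descent `𝒪_{ℂ_p}⟦T⟧ → ℤ_p⟦T⟧`
(`iwasawaAlgebra_dvd_of_map_dvd_map_padicComplexInt`), Kato–Kobayashi Thm 4.1 for `W` and `W₂` (integral under `Surj`,
Wuthrich Lemma 20), the two-factor squeeze, Néron normalisation by the period unit. CONDITIONAL; closes nothing.
[cite: BurungaleSkinnerTianWan2024, §2.3 proof of Thm. (KoMC_r)] [cite: Kobayashi2003, Thm. 1.2, Thm. 4.1 (p. 8)] -/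
theorem kobayashiMainConjecture_of_twoVariableDvd
    (h12 : Kobayashi2003.thm12_signedSelmerDual_finite_torsion) (h41 : Kobayashi2003.thm41_signedCharIdeal_divisibility)
    (hmod : nonempty_modularParametrizationData) (h5 : realPeriodRat_eq_unit_mul_plusPeriod) :
    ∀ {p : ℕ} [Fact p.Prime] (ι : PadicAlgCl p ≃+* ℂ) (W : WeierstrassCurve ℚ) [W.IsElliptic]
      [W.IsGloballyMinimal] (K : Type) [Field K] [NumberField K] (v vbar : HeightOneSpectrum (𝓞 K))
      (κ₁ κ₂ : ZpExtension K p) (γ₁ γ₂ : absoluteGaloisGroup K)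
      [Fact (ZpExtension.IsTopGeneratorPair κ₁ κ₂ γ₁ γ₂)] {N : ℕ} [NeZero N] (f : CuspForm (Gamma0 N) 2)
      [NeZero (NumberField.discr K).natAbs],
      IsNewformOf W f → (N : ℤ) = W.conductorNorm ℤ → p ≠ 2 → ¬ (p : ℤ) ∣ W.conductorNorm ℤ →
      W.frobeniusTrace p = 0 →
      IsImaginaryQuadratic K → ((Ideal.span {(p : ℤ)}).primesOver (𝓞 K)).ncard = 2 →
      ((p : ℕ) : 𝓞 K) ∈ v.asIdeal → ((p : ℕ) : 𝓞 K) ∈ vbar.asIdeal → vbar ≠ v →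
      (∀ (w : InfinitePlace K) (k : 𝓞 K), k ∈ v.asIdeal ↔ ‖ι.symm (w.embedding (k : K))‖ < 1) →
      IsCoprime (N : ℤ) (NumberField.discr K) →
      5 ≤ p → Rank1Residual.ClassX6 W p →
      (∀ ρ : ModPGaloisRep K (ZMod p) 2, (W.baseChange K).IsTorsionGaloisRep p ρ →
        FramedRep.IsAbsolutelyIrreducible ρ) →
      κ₁.IsCyclotomic → κ₂.IsAnticyclotomic →
      -- «γ₁ canonical»
      (∃ ζ : ℤ_[p]ˣ, IsOfFinOrder ζ ∧
        ((GaloisRep.cyclotomicCharacter K p γ₁ * ζ : ℤ_[p]ˣ) : ℤ_[p]) = (cyclotomicGenerator p : ℤ_[p])) →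
      ∀ (Ω δ : ℂ) (Ωp : (unrIntegers p)ˣ) (LK G : PowerSeries (PowerSeries (PadicComplexInt p))),
        Ω ≠ 0 → (δ ^ 2 = (NumberField.discr K : ℂ) ∨ δ ^ 2 = -(NumberField.discr K : ℂ)) →
        IsKatzMeasure₂ ι v vbar ∅ κ₁ κ₂ γ₁⁻¹ γ₂⁻¹ 1 Ω δ ((Ωp : unrIntegers p) : PadicComplex p) LK →
        IsGreenbergLFunctionAnyRoot₂ ι v vbar κ₁ κ₂ γ₁⁻¹ γ₂⁻¹ f (NumberField.discr K).natAbs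
          (NumberField.classNumber K) LK G →
      ∀ J : ℤ_[p] →+* PadicComplexInt p,
        (∀ x : ℤ_[p], ((J x : PadicComplexInt p) : PadicComplex p) = ((x : ℚ_[p]) : PadicComplex p)) →
      ∀ ε : ℤˣ,
      ∀ xi Lsig : PowerSeries (PowerSeries (PadicComplexInt p)),
        Lsig ∣ xi →
        (Ideal.span {xi * G} =
            (WeierstrassCurve.XGr₂.charIdeal (W.baseChange K) p κ₁ κ₂ vbar γ₁ γ₂).map
                (IwasawaAlgebra₂.toUnr₂ p J) * Ideal.span {Lsig} ∧
        ∀ (κ : ZpExtension ℚ p) (γ : absoluteGaloisGroup ℚ), κ.IsCyclotomic → κ.IsTopGenerator γ →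
          IsCyclotomicVariable p γ →
          (∃ ζ : ℤ_[p]ˣ, IsOfFinOrder ζ ∧
            GaloisRep.cyclotomicCharacter ℚ p γ * ζ = GaloisRep.cyclotomicCharacter K p γ₁) →
          ∀ (W₂ : WeierstrassCurve ℚ) [W₂.IsElliptic] [W₂.IsGloballyMinimal]
            (C₂ : WeierstrassCurve.VariableChange ℚ),
            C₂ • W₂ = W.quadraticTwist (NumberField.discr K : ℚ) →
            (∀ (D₁ : Kobayashi2003.SignedSelmerDualData W κ γ ε)
                (D₂ : Kobayashi2003.SignedSelmerDualData W₂ κ γ ε) (g₁ g₂ : IwasawaAlgebra p),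
                D₁.charIdeal = Ideal.span {g₁} → D₂.charIdeal = Ideal.span {g₂} →
                UnrSeries₂.plus xi ∣ PowerSeries.map J (g₁ * g₂)) ∧
            (∀ {N₂ : ℕ} [NeZero N₂] (f₂ : CuspForm (Gamma0 N₂) 2), IsNewformOf W₂ f₂ →
              ∀ (L₁ L₂ : IwasawaAlgebra p), Kobayashi2003.IsSignedPAdicLFunction f p ε L₁ →
                Kobayashi2003.IsSignedPAdicLFunction f₂ p ε L₂ →
                ∃ u : PowerSeries (PadicComplexInt p), IsUnit u ∧
                  UnrSeries₂.plus Lsig = u * PowerSeries.map J (L₁ * L₂))) →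
        Summit.BirchSwinnertonDyer.Rank1Residual.Supersingular.KobayashiMainConjecture W p ε := by
  intro p _ ι W _ _ K _ _ v vbar κ₁ κ₂ γ₁ γ₂ _ N _ f _ hf hN hp2 hpN hap hK hsplit hv hvbar hvv
    hι hcop hp5 hX hirr hκ₁ hκ₂ hcan Ω δ Ωp LK G hΩ hδ hLK hG J hJ ε xi Ls hdvd hpkg
  obtain ⟨hP1, hline⟩ := hpkg
  -- basics at `p` for `W` (X6 ⇒ good supersingular, `ρ̄` onto, `E[p]` irreducible)
  have hpP : p.Prime := Fact.out
  have hgood : W.HasGoodReductionAtPrime p := hX.1.1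
  have hs : Surj W p := ClassX6.surj W p hp2 hX
  have hirrW : Irr W p := ClassX6.irr W p hp2 hX
  -- the auxiliary curve `W₂ ≃ W^{(D_K)}`: good at `p`, `a_p = 0`, `ρ̄` onto (`p ∤ D_K` as `p` splits)
  have hpD : ¬ (p : ℤ) ∣ NumberField.discr K := not_dvd_discr_of_ncard_primesOver_eq_two hK.1 hpP hsplit
  have hD0 : (NumberField.discr K : ℚ) ≠ 0 := by exact_mod_cast NumberField.discr_ne_zero K
  obtain ⟨W₂, _, _, C₂, hC₂⟩ := exists_isGloballyMinimal_smul_eq_quadraticTwist W hD0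
  obtain ⟨hgood₂, hap₂, hs₂⟩ :=
    goodSS_surj_of_smul_eq_quadraticTwist_discr hK.1 W W₂ p hp2 hpD hC₂ hgood hap hs
  -- levels = conductors: Kobayashi's conjecture binds the conductor-level newform, which is `f` (uniqueness)
  have hNn : N = W.conductorNorm ℤ := by exact_mod_cast hN
  subst hNn
  intro κ γ hκ hγ hγ' _ fK hfK ϖ hϖ Lp Lm hPP D
  have hfeq : f = fK := hf.unique hfK
  subst hfeq
  -- Thm. 1.2 for `W`
  haveI hfin : Module.Finite (IwasawaAlgebra p) D.X := h12.moduleFinite hp2 hgood hap hκ hγ D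
  have hXt : Module.IsTorsion (IwasawaAlgebra p) D.X := h12.isTorsion hp2 hgood hap hκ hγ D
  refine ⟨hXt, ?_⟩
  obtain ⟨g₁, hg₁⟩ := (charIdeal_isPrincipal_holds p D.X).principal
  have hg₁' : D.charIdeal = Ideal.span {g₁} := hg₁
  -- auxiliary data for `W₂`: newform (modularity), Pollack pair, Selmer datum, generator
  haveI : NeZero (W₂.conductorNorm ℤ) := ⟨(W₂.conductorNorm_pos_holds).ne'⟩
  obtain ⟨Dm₂⟩ := hmod W₂
  obtain ⟨Lp₂, Lm₂, hPP₂⟩ :=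
    exists_isPollackPair pollack_exists_plusMinusPAdicLFunction_holds hp2 Dm₂.isNewformOf hgood₂ hap₂
  obtain ⟨D₂⟩ := nonempty_signedSelmerDualData W₂ κ ε hγ
  obtain ⟨g₂, hg₂⟩ := (charIdeal_isPrincipal_holds p D₂.X).principal
  have hg₂' : D₂.charIdeal = Ideal.span {g₂} := hg₂
  -- the cyclotomic-line clauses (P2), (P3) for `(W, W₂)` at the canonical `ℚ`-variable `γ`
  have hcoord := exists_isOfFinOrder_mul_eq_of_canonical hcan hγ'
  obtain ⟨hP2, hP3⟩ := hline κ γ hκ hγ hγ' hcoord W₂ C₂ hC₂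
  have hL₁ := hPP.isSignedPAdicLFunction_kobayashiL ε
  have hL₂ := hPP₂.isSignedPAdicLFunction_kobayashiL ε
  have h2 := hP2 D D₂ g₁ g₂ hg₁' hg₂'
  obtain ⟨u, hu, h3⟩ := hP3 Dm₂.f Dm₂.isNewformOf _ _ hL₁ hL₂
  -- from the two-variable divisibility `𝓛^∘ ∣ ξ_∘`: descend through `plus` with (P2), (P3)
  have hS : PowerSeries.map J (kobayashiL ε Lp Lm * kobayashiL ε Lp₂ Lm₂) * 1 ∣
      PowerSeries.map J (g₁ * g₂) * 1 :=
    mul_dvd_mul_of_map_of_dvd_of_eq_unit_mul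
      (PowerSeries.map (PowerSeries.constantCoeff (R := PadicComplexInt p)))
      (ξ' := 1) (L' := 1) (a' := 1) (b' := 1) (u' := 1)
      (by simpa using hdvd) h2 (by simp) hu isUnit_one h3 (by simp)
  rw [mul_one, mul_one] at hS
  -- descend to `ℤ_p⟦T⟧`
  have hZ : kobayashiL ε Lp Lm * kobayashiL ε Lp₂ Lm₂ ∣ g₁ * g₂ :=
    Summit.BirchSwinnertonDyer.BirchSwinnertonDyer.Theorems.SignedBaseChangeK2RDivisibilityDescent.iwasawaAlgebra_dvd_of_map_dvd_map_padicComplexInt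
      hJ hS
  -- Kobayashi Thm. 4.1 (integral under `Surj`) for `W` and `W₂`
  have hL20 := Wuthrich2014.lemma20_surjective_threeAdic_of_semistable_holds
  have hK₁ : g₁ ∣ kobayashiL ε Lp Lm :=
    h41.dvd_of_charIdeal_eq_span hp2 hgood hap hfK hκ hγ hγ' hL₁ D hXt
      (surjective_pow_of_surj_of_good W p hL20 hp2 hgood hs) hg₁'
  haveI : Module.Finite (IwasawaAlgebra p) D₂.X := h12.moduleFinite hp2 hgood₂ hap₂ hκ hγ D₂
  have hK₂ : g₂ ∣ kobayashiL ε Lp₂ Lm₂ :=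
    h41.dvd_of_charIdeal_eq_span hp2 hgood₂ hap₂ Dm₂.isNewformOf hκ hγ hγ' hL₂ D₂
      (h12.isTorsion hp2 hgood₂ hap₂ hκ hγ D₂) (surjective_pow_of_surj_of_good W₂ p hL20 hp2 hgood₂ hs₂) hg₂'
  -- two-factor squeeze: `(g₁) = (L^ε(f))`
  have hassoc₁ : Associated g₁ (kobayashiL ε Lp Lm) :=
    associated_of_dvd_of_mul4_dvd (g₃ := 1) (g₄ := 1) (L₃ := 1) (L₄ := 1) hK₁ hK₂ (dvd_refl 1) (dvd_refl 1)
      (kobayashiL_ne_zero hPP ε) (kobayashiL_ne_zero hPP₂ ε) one_ne_zero one_ne_zero (by simpa using hZ)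
  have hchar : D.charIdeal = Ideal.span {kobayashiL ε Lp Lm} := by
    rw [hg₁']; exact Ideal.span_singleton_eq_span_singleton.mpr hassoc₁
  -- Néron normalisation: `ϖ` is a `p`-adic unit
  set L := kobayashiL ε Lp Lm with hL_def
  have hvϖ : padicValRat p ϖ = 0 :=
    padicValRat_periodRatio_eq_zero_of_five_le h5 W p hp5 hgood hirrW _ hfK ϖ hϖ
  have hϖ0 : ϖ ≠ 0 := by
    intro hz
    rw [hz, Rat.cast_zero, zero_mul] at hϖ
    exact (IsNewform0.plusPeriod_pos_holds hfK.1 hfK.coeffField_eq_bot).ne' hϖ.symm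
  obtain ⟨u₁, hu₁⟩ := exists_units_coe_eq_ratCast hϖ0 hvϖ
  obtain ⟨hspan', hι'⟩ := span_C_units_mul_eq u₁ L
  refine ⟨PowerSeries.C (u₁ : ℤ_[p]) * L, ?_, ?_⟩
  · rw [hchar, hspan']
  · rw [hι', hu₁]

/-! ### §3 The `5 ≤ p` branch of crux 2 from S1aʳ ⊕ Cμ ⊕ six named facts (crux workfile `five_le_of_defmu` with S1bʳ
### DISCHARGED by `SemistableDefiniteFrameData.definiteFieldSupplyFromR`, p625235, and `NamedInputs₂` unbundled) -/

/-- **The `5 ≤ p` half of crux 2 `KobayashiLowerHalfSemistable`, BY THE KERNEL, from exactly: S1aʳ (`h1a`, the registered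
stub `stub_ramifiedLevelPrimeR` VERBATIM — PUB, Ribet/Diamond; tree-conditional `ramifiedLevelPrimeR_of_levelLowering`), Cμ
(`hC`, the registered HARD stub `stub_definitePackageMu` VERBATIM — the BSTW signed two-variable package at the definite-CR
datum with unit content of `𝓛^∘(0,T₂)`; PRE ⊕ PUB ⊕ one comparison), and six NAMED facts (`h617` BSTW Thm 6.17 frames,
PRE binder; `h12`/`h41` Kobayashi Thms 1.2/4.1; `hmod` modularity; `hper` the period unit; `h924` GMC_r = BSTW Thm 9.24, OPEN
binder).** For every globally minimal `W/ℚ` and prime `p ≠ 2` with `ClassX6 W p` and `5 ≤ p`: `∃ ε, KobayashiLowerDivisibility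
W p ε` (witness `ε = 1`, from the full main conjecture). Proof = the crux workfile's `five_le_of_defmu`: S1aʳ gives `q₀`;
S1bʳ (landed, p625235) the definite `K`, frame primes, canonical tower, `ι`, irreducibility over `K`; `h617` a frame; a
structure map `J`; Cμ the package; `h924` the cyclotomic witness `s` ((spl) ← `q₀` inert; `N` square-free ← X6); `G ≠ 0`
free; §1 gives `𝓛^∘ ∣ ξ_∘`; §2 descends. CONDITIONAL on the displayed hypotheses (`conditional-result`); closes nothing;
the item stays OPEN. [cite: BurungaleSkinnerTianWan2024, §2.3 proof of Thm. (KoMC_r), Props. 1.18, 2.7, 5.19, Thm. 6.17, Thm. 9.24]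
[cite: Kobayashi2003, Conjecture (Main Conjecture) (p. 2), Thm. 1.2, Thm. 4.1] [cite: PollackWeston2011, Thm. 2.5] -/
theorem exists_kobayashiLowerDivisibility_of_package
    (h1a :
      ∀ (p : ℕ) [Fact p.Prime] (W : WeierstrassCurve ℚ) [W.IsElliptic] [W.IsGloballyMinimal],
        5 ≤ p → Rank1Residual.ClassX6 W p →
        ∃ q₀ : ℕ, q₀.Prime ∧ (q₀ : ℤ) ∣ W.conductorNorm ℤ ∧ ¬ ((p : ℤ) ∣ padicValRat q₀ W.Δ))
    (hC :
      ∀ {p : ℕ} [Fact p.Prime] (ι : PadicAlgCl p ≃+* ℂ) (W : WeierstrassCurve ℚ) [W.IsElliptic]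
        [W.IsGloballyMinimal] (K : Type) [Field K] [NumberField K] (v vbar : HeightOneSpectrum (𝓞 K))
        (κ₁ κ₂ : ZpExtension K p) (γ₁ γ₂ : absoluteGaloisGroup K)
        [Fact (ZpExtension.IsTopGeneratorPair κ₁ κ₂ γ₁ γ₂)] {N : ℕ} [NeZero N] (f : CuspForm (Gamma0 N) 2)
        [NeZero (NumberField.discr K).natAbs],
        IsNewformOf W f → (N : ℤ) = W.conductorNorm ℤ → p ≠ 2 → ¬ (p : ℤ) ∣ W.conductorNorm ℤ →
        W.frobeniusTrace p = 0 →
        IsImaginaryQuadratic K → ((Ideal.span {(p : ℤ)}).primesOver (𝓞 K)).ncard = 2 →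
        ((p : ℕ) : 𝓞 K) ∈ v.asIdeal → ((p : ℕ) : 𝓞 K) ∈ vbar.asIdeal → vbar ≠ v →
        (∀ (w : InfinitePlace K) (k : 𝓞 K), k ∈ v.asIdeal ↔ ‖ι.symm (w.embedding (k : K))‖ < 1) →
        IsCoprime (N : ℤ) (NumberField.discr K) →
        -- ⟨definite-CR datum, rev 5: X6 at 5 ≤ p; ONE prime q₀ ∥ N inert in K, every other ℓ ∣ N split; `2` split or
        --  `2 ∣ N` ((spl) of BSTW Thm 9.24); (CR, RAMIFIED branch only) `p ∤ v_{q₀}(Δ_W)` (ρ̄ ramified at q₀, `p ∤ c_{q₀}`)⟩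
        5 ≤ p → Rank1Residual.ClassX6 W p →
        ∀ q₀ : ℕ, q₀.Prime → q₀ ∣ N → ¬ (q₀ ^ 2 ∣ N) →
          ((Ideal.span {(q₀ : ℤ)}).primesOver (𝓞 K)).ncard = 1 →
          (∀ ℓ : ℕ, ℓ.Prime → ℓ ∣ N → ℓ ≠ q₀ → ((Ideal.span {(ℓ : ℤ)}).primesOver (𝓞 K)).ncard = 2) →
          (((Ideal.span {(2 : ℤ)}).primesOver (𝓞 K)).ncard = 2 ∨ 2 ∣ N) →
          ¬ ((p : ℤ) ∣ padicValRat q₀ W.Δ) →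
        (∀ ρ : ModPGaloisRep K (ZMod p) 2, (W.baseChange K).IsTorsionGaloisRep p ρ →
          FramedRep.IsAbsolutelyIrreducible ρ) →
        κ₁.IsCyclotomic → κ₂.IsAnticyclotomic →
        ∀ (Ω δ : ℂ) (Ωp : (unrIntegers p)ˣ) (LK G : PowerSeries (PowerSeries (PadicComplexInt p))),
          Ω ≠ 0 → (δ ^ 2 = (NumberField.discr K : ℂ) ∨ δ ^ 2 = -(NumberField.discr K : ℂ)) →
          IsKatzMeasure₂ ι v vbar ∅ κ₁ κ₂ γ₁⁻¹ γ₂⁻¹ 1 Ω δ ((Ωp : unrIntegers p) : PadicComplex p) LK →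
          IsGreenbergLFunctionAnyRoot₂ ι v vbar κ₁ κ₂ γ₁⁻¹ γ₂⁻¹ f (NumberField.discr K).natAbs
            (NumberField.classNumber K) LK G →
        ∀ J : ℤ_[p] →+* PadicComplexInt p,
          (∀ x : ℤ_[p], ((J x : PadicComplexInt p) : PadicComplex p) = ((x : ℚ_[p]) : PadicComplex p)) →
        ∀ ε : ℤˣ,
        ∃ xi Lsig : PowerSeries (PowerSeries (PadicComplexInt p)),
          GreenbergVatsal2000.HasUnitContent (UnrSeries₂.minus Lsig) ∧
          (Ideal.span {xi * G} =
              (WeierstrassCurve.XGr₂.charIdeal (W.baseChange K) p κ₁ κ₂ vbar γ₁ γ₂).map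
                  (IwasawaAlgebra₂.toUnr₂ p J) * Ideal.span {Lsig} ∧
          ∀ (κ : ZpExtension ℚ p) (γ : absoluteGaloisGroup ℚ), κ.IsCyclotomic → κ.IsTopGenerator γ →
            IsCyclotomicVariable p γ →
            (∃ ζ : ℤ_[p]ˣ, IsOfFinOrder ζ ∧
              GaloisRep.cyclotomicCharacter ℚ p γ * ζ = GaloisRep.cyclotomicCharacter K p γ₁) →
            ∀ (W₂ : WeierstrassCurve ℚ) [W₂.IsElliptic] [W₂.IsGloballyMinimal]
              (C₂ : WeierstrassCurve.VariableChange ℚ),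
              C₂ • W₂ = W.quadraticTwist (NumberField.discr K : ℚ) →
              (∀ (D₁ : Kobayashi2003.SignedSelmerDualData W κ γ ε)
                  (D₂ : Kobayashi2003.SignedSelmerDualData W₂ κ γ ε) (g₁ g₂ : IwasawaAlgebra p),
                  D₁.charIdeal = Ideal.span {g₁} → D₂.charIdeal = Ideal.span {g₂} →
                  UnrSeries₂.plus xi ∣ PowerSeries.map J (g₁ * g₂)) ∧
              (∀ {N₂ : ℕ} [NeZero N₂] (f₂ : CuspForm (Gamma0 N₂) 2), IsNewformOf W₂ f₂ →
                ∀ (L₁ L₂ : IwasawaAlgebra p), Kobayashi2003.IsSignedPAdicLFunction f p ε L₁ →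
                  Kobayashi2003.IsSignedPAdicLFunction f₂ p ε L₂ →
                  ∃ u : PowerSeries (PadicComplexInt p), IsUnit u ∧
                    UnrSeries₂.plus Lsig = u * PowerSeries.map J (L₁ * L₂))))
    (h617 : thm617_exists_isGreenbergLFunctionAnyRoot₂_supersingular_PRE)
    (h12 : Kobayashi2003.thm12_signedSelmerDual_finite_torsion)
    (h41 : Kobayashi2003.thm41_signedCharIdeal_divisibility)
    (hmod : nonempty_modularParametrizationData)
    (hper : realPeriodRat_eq_unit_mul_plusPeriod)
    (h924 : thm924_greenberg_dvd_charIdealXGr₂_awayFromCyc_OPEN)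
    (W : WeierstrassCurve ℚ) [W.IsElliptic] [W.IsGloballyMinimal] (p : ℕ) [Fact p.Prime]
    (hp : p ≠ 2) (hX : Rank1Residual.ClassX6 W p) (h5p : 5 ≤ p) :
    ∃ ε : ℤˣ, Summit.BirchSwinnertonDyer.Rank1Residual.Supersingular.KobayashiLowerDivisibility W p ε := by
  haveI : NeZero (W.conductorNorm ℤ) := ⟨(W.conductorNorm_pos_holds).ne'⟩
  obtain ⟨π⟩ := hmod W
  -- the local facts at `p` read off the class, and square-freeness of `N_W` from semistability
  have hgood : W.HasGoodReductionAtPrime p := hX.1.1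
  have hpN' : ¬ p ∣ W.conductorNorm ℤ := not_dvd_conductorNorm_of_hasGoodReductionAtPrime W hgood
  have hpN : ¬ (p : ℤ) ∣ W.conductorNorm ℤ := by exact_mod_cast hpN'
  have ha0 : W.frobeniusTrace p = 0 := (W.natCast_dvd_frobeniusTrace_iff_eq_zero p h5p hgood).mp hX.1.2
  have hN : ((W.conductorNorm ℤ : ℕ) : ℤ) = W.conductorNorm ℤ := rfl
  have hsq : Squarefree (W.conductorNorm ℤ) :=
    (W.isSemistable_iff_squarefree_conductorNorm).mp ((Rank1Residual.semistable_iff_isSemistable_int W).mp hX.2.1)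
  -- S1aʳ: the ramified level prime; S1bʳ: the definite datum with this `q₀` inert
  obtain ⟨q₀, hq₀, hqN, hCR⟩ := h1a p W h5p hX
  obtain ⟨K, _, _, ι, v, vbar, κ₁, κ₂, γ₁, γ₂, _, _, hIQ, hsp, hv, hvbar, hvv, hι, hcop, hq₀', hqN', hq2, hin, hspl,
    h2K, hCR', hirr, hκ₁, hκ₂, hcan⟩ := SemistableDefiniteFrameData.definiteFieldSupplyFromR p W (W.conductorNorm ℤ) hN h5p hX q₀ hq₀ hqN hCR
  -- a Katz/Greenberg frame for `π.f` over `K`, and a structure map `J`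
  obtain ⟨Ω, δ, Ωp, LK, G, hΩ, hδ, hLK, hGr⟩ :=
    h617 ι W K v vbar κ₁ κ₂ γ₁ γ₂ π.isNewformOf hN h5p hpN ha0 hIQ hsp hv hvbar hvv hι hcop hκ₁ hκ₂
  obtain ⟨J, hJ⟩ := exists_structureMap_padicInt (p := p)
  refine ⟨1, Summit.BirchSwinnertonDyer.Rank1Residual.Supersingular.kobayashiLowerDivisibility_of_mainConjecture ?_⟩
  -- Cμ: the package with unit content on the anticyclotomic line, for `ε = 1`
  obtain ⟨xi, Lsig, hμ, hP1, hline⟩ := hC ι W K v vbar κ₁ κ₂ γ₁ γ₂ π.f π.isNewformOf hN hp hpN ha0 hIQ hsp hv hvbar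
    hvv hι hcop h5p hX q₀ hq₀' hqN' hq2 hin hspl h2K hCR' hirr hκ₁ hκ₂ Ω δ Ωp LK G hΩ hδ hLK hGr J hJ 1
  -- GMC_r (BSTW Thm 9.24, BY NAME): the cyclotomic-variable witness `s`; (spl) from `q₀` inert
  obtain ⟨s, hs, hle⟩ := h924 ι W K v vbar κ₁ κ₂ γ₁ γ₂ π.isNewformOf hN hsq hp hpN' hIQ hsp hv hvbar hvv hι hcop
    hirr ⟨q₀, hq₀', hqN', by rw [hin]; decide⟩ h2K hκ₁ hκ₂ Ω δ Ωp LK G hΩ hδ hLK hGr J hJ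
  -- `G ≠ 0` is free: (P1), `ch ≠ ⊥`, `𝓛^∘ ≠ 0`
  have hLs : Lsig ≠ 0 := ne_zero_of_hasUnitContent_minus hμ
  have hG0 : G ≠ 0 :=
    ne_zero_of_span_mul_eq hP1 (map_charIdealXGr₂_ne_bot _ κ₁ κ₂ vbar γ₁ γ₂ (structureMap_injective hJ)) hLs
  -- the μ-transfer: `𝓛^∘ ∣ ξ_∘` two-variably
  have hdvd : Lsig ∣ xi := dvd_of_awayFromCyc_of_package hμ hs hle hP1 hG0
  -- S5ʳ: descend and squeeze
  exact kobayashiMainConjecture_of_twoVariableDvd h12 h41 hmod hper ι W K v vbar κ₁ κ₂ γ₁ γ₂ π.f π.isNewformOf hN hp hpN ha0 hIQ hsp hv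
    hvbar hvv hι hcop h5p hX hirr hκ₁ hκ₂ hcan Ω δ Ωp LK G hΩ hδ hLK hGr J hJ 1 xi Lsig hdvd ⟨hP1, hline⟩

end Summit.BirchSwinnertonDyer.BirchSwinnertonDyer.Theorems.SemistableDefmuAssembly

end
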